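import Summits.CriticalPhenomena.SAWScalingLimit.Theorems.LeftRightFKG.Negative.PAFamily4Lemmas
import Summits.CriticalPhenomena.SAWScalingLimit.Theorems.LeftRightFKG.Negative.PACert4Pairs1
import Summits.CriticalPhenomena.SAWScalingLimit.Theorems.LeftRightFKG.Negative.PACert4Pairs2
import Summits.CriticalPhenomena.SAWScalingLimit.Theorems.LeftRightFKG.Negative.PACert4Pairs3
import Summits.CriticalPhenomena.SAWScalingLimit.Theorems.LeftRightFKG.Negative.InstancePA
import Summits.CriticalPhenomena.SAWScalingLimit.Theorems.LeftRightFKG.Negative.CornerCertXc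
import HarnessLib

/-!
# Negative knowledge on crux `LeftRightFKG`, part 22: `LeftRightFKG` for `δ = 1` and the contour `C = C₄`, ALL
endpoints (computational grade)

Crux `stmt-CriticalPhenomena-11232` (`Summit.CriticalPhenomena.SAWScalingLimit.Theses.SAWLeftRightFKG.LeftRightFKG`)
quantifies over `δ, c, a, b, a', b', C, A, B`.  This file settles the whole slice `δ = 1`, `C = C₄` (the boundary walk
of `[-1,4]²`, part 8): **`weight_pa_C₄`** — for ALL endpoint data `(a, b, a', b')` forming a crux instance on `C₄`
(`IsInst 1 a b a' b' C₄`: `a', b'` on the contour, `a ~ a'`, `b ~ b'`) and ALL `≼`-up-closed `A`, `B`,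
`w(A) w(B) ≤ w(univ) w(A ∩ B)`, `w = SAW.weight`; and **`pa_C₄`**, the same for the fugacity-`x` chord measure at
every `x` of the computational window `[200/539, 5/13] ∋ x_c`.

Proof: degenerate endpoint data (`a = b`, or an endpoint outside the box) have at most one chord
(`subsingleton_domainSAW`, part 20) and trivial blocks (`cornerBlock_of_subsingleton`); otherwise
`(toZ2 a, toZ2 b)` is an ordered pair of distinct boundary-adjacent sites (`toZ2_mem_bsites₄`), certified by one of the
three chunks of part 21 (`checkAll_pairs₄`), and `cornerBlock_of_checkAll` (part 17) feeds
`CornerLoc.pa_inst_of_cornerBlock` (part 13).  Computational grade: the chunks and the window are `native_decide`.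
Elementary ("folklore") modulo the compiled evaluations.
-/

namespace Summit.CriticalPhenomena.SAWScalingLimit.Theorems.LeftRightFKG.Negative.PAKit

open Literature.Analysis.ValidatedNumerics
open PolyMP (evalR addR mulR smulR posOn)
open PolyCert (realOf minorI)
open Census (censusList census)

/-! ## §11c The `C₄` family theorem: `LeftRightFKG` for `δ = 1`, `C = C₄` and ALL endpoints -/

section Family4

open Finset
open Literature.Probability.LatticeModels Literature.Probability.RandomPlanarGeometry
open CornerLoc (cls restrP IsUpOn NextDet PrevDet IsUp IsInst dom μx)
open CornerCert (C₄ inV₄ dAdj₄_iff criticalFugacity_mem_compWindow)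
open scoped Classical

/-- The three chunks assembled: every ordered pair of distinct boundary-adjacent sites passes. [folklore] -/
theorem checkAll_pairs₄ {p q : ℤ × ℤ} (hp : p ∈ [((0 : ℤ), (0 : ℤ)), (0, 1), (0, 2), (0, 3), (1, 0), (1, 3),
      (2, 0), (2, 3), (3, 0), (3, 1), (3, 2), (3, 3)]) (hq : q ∈ [((0 : ℤ), (0 : ℤ)), (0, 1), (0, 2), (0, 3), (1, 0), (1, 3),
      (2, 0), (2, 3), (3, 0), (3, 1), (3, 2), (3, 3)]) (hpq : p ≠ q) :
    checkAll ⟨q, 0, 3, 0, 3, 15, 2 ^ 64, 6, 200 / 539, 5 / 13⟩ (codes inV₄ 15 p q) = true := by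
  simp only [List.mem_cons, List.not_mem_nil, or_false] at hp
  rcases hp with rfl | rfl | rfl | rfl | rfl | rfl | rfl | rfl | rfl | rfl | rfl | rfl <;>
    first
    | exact checkAll_pairs₄_1 _ (by decide) q hq hpq
    | exact checkAll_pairs₄_2 _ (by decide) q hq hpq
    | exact checkAll_pairs₄_3 _ (by decide) q hq hpq

/-- Every chord of a `C₄` instance starting at a box site has at most `15` steps. [folklore] -/
theorem length_le₄' {a b : Site 2} (ha : inV₄ (toZ2 a) = true) (γ : SAW.DomainSAW (dom C₄ 1) 1 a b) :
    γ.length ≤ 15 := by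
  refine Census.length_le_of_card (inV := inV₄) dAdj₄_iff (T := (Finset.Icc (0 : ℤ) 3) ×ˢ (Finset.Icc (0 : ℤ) 3))
    (fun p hp => ?_) ha (by decide) γ
  simp only [inV₄, Bool.and_eq_true, decide_eq_true_eq] at hp
  simp only [Finset.mem_product, Finset.mem_Icc]
  omega

/-- **Positive association at every fugacity of the computational window, for EVERY crux instance on the contour
`C₄` at mesh `1`** (all endpoints `a, b` and boundary neighbours `a', b'`): degenerate endpoint data give at most one
chord (`subsingleton_domainSAW`, trivial blocks); otherwise `(toZ2 a, toZ2 b)` is one of the 132 certified pairs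
(`toZ2_mem_bsites₄`, `checkAll_pairs₄`) and `cornerBlock_of_checkAll` applies. [folklore] -/
theorem pa_C₄ {x : ℝ} (hlo : ((200 / 539 : ℚ) : ℝ) ≤ x) (hhi : x ≤ ((5 / 13 : ℚ) : ℝ)) {a b a' b' : Site 2}
    (hI : IsInst 1 a b a' b' C₄) (A B : Set (SAW.DomainSAW (dom C₄ 1) 1 a b)) (hA : IsUp A) (hB : IsUp B) :
    μx x (dom C₄ 1) 1 a b A * μx x (dom C₄ 1) 1 a b B ≤
      μx x (dom C₄ 1) 1 a b Set.univ * μx x (dom C₄ 1) 1 a b (A ∩ B) := by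
  haveI := CornerLoc.finite_domainSAW (a := a) (b := b) C₄ one_pos
  haveI : Fintype (SAW.DomainSAW (dom C₄ 1) 1 a b) := Fintype.ofFinite _
  have hx : 0 < x := lt_of_lt_of_le (by norm_num) hlo
  by_cases hdeg : a ≠ b ∧ inV₄ (toZ2 a) = true ∧ inV₄ (toZ2 b) = true
  · obtain ⟨hab, ha, hb⟩ := hdeg
    obtain ⟨-, ha', hb', haa', hbb'⟩ := id hI
    have hcheck := checkAll_pairs₄ (toZ2_mem_bsites₄ ha ha' haa') (toZ2_mem_bsites₄ hb hb' hbb')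
      (fun h => hab (toZ2_injective h))
    refine CornerLoc.pa_inst_of_cornerBlock hx hI ?_ A B hA hB
    exact cornerBlock_of_checkAll (Ω := dom C₄ 1) (g := ⟨toZ2 b, 0, 3, 0, 3, 15, 2 ^ 64, 6, 200 / 539, 5 / 13⟩)
      (fun x y => dAdj₄_iff x y) rfl (fun γ => length_le₄' ha γ) ha
      (fun p hp => by
        simp only [inV₄, Bool.and_eq_true, decide_eq_true_eq] at hp
        exact ⟨⟨hp.1.1.1, hp.1.1.2⟩, hp.1.2, hp.2⟩)
      (codes_nodup _ _ _ _) hcheck (by norm_num) (by norm_num) (by norm_num) hlo hhi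
  · haveI := subsingleton_domainSAW (Ω := dom C₄ 1) dAdj₄_iff hdeg
    exact CornerLoc.pa_inst_of_cornerBlock hx hI (cornerBlock_of_subsingleton x) A B hA hB

/-- **`LeftRightFKG` HOLDS FOR `δ = 1` AND THE CONTOUR `C = C₄`** (computational grade): for all endpoint data
`a, b, a', b'` of a crux instance on `C₄` and ALL `≼`-up-closed `A`, `B`, `w(A) w(B) ≤ w(univ) w(A ∩ B)`,
`w = SAW.weight`. [folklore] -/
theorem weight_pa_C₄ {a b a' b' : Site 2} (hI : IsInst 1 a b a' b' C₄)
    (A B : Set (SAW.DomainSAW (dom C₄ 1) 1 a b)) (hA : IsUp A) (hB : IsUp B) :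
    SAW.weight (dom C₄ 1) 1 a b A * SAW.weight (dom C₄ 1) 1 a b B ≤
      SAW.weight (dom C₄ 1) 1 a b Set.univ * SAW.weight (dom C₄ 1) 1 a b (A ∩ B) := by
  simpa only [CornerLoc.weight_eq_μx] using
    pa_C₄ criticalFugacity_mem_compWindow.1 criticalFugacity_mem_compWindow.2 hI A B hA hB

end Family4

end Summit.CriticalPhenomena.SAWScalingLimit.Theorems.LeftRightFKG.Negative.PAKit
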